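import Literature.MathematicalPhysics.QuantumFieldTheory.Balaban1983to89.Beta.WilsonWard22
import Summits.QuantumFields.BalabanUV.Beta.WilsonBackgroundWard22
import Summits.QuantumFields.BalabanUV.Beta.WilsonBackgroundWard22Upper

/-!
# The BACKGROUND-gauge Ward identity of the Wilson plaquette jets at order `(W², B¹)`; part 3: the four COLUMNS (the background
# quadruple general), from the entries by B-additivity

Third file of (bgW₂) — READ THE HEADER of `Summits/QuantumFields/BalabanUV/Beta/WilsonBackgroundWard22.lean` for the honest framing,
the setting (an3's letters), the identity
  `4·Pol_B F_{2,2}(h ; B, W₀λ) + 4·Pol_W F_{2,1}(h, ad_λ h ; B) + 2·F_{2,1}(h ; [λ(b₋)+λ(b₊), B]) = 0`        (bgW₂)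
its group-level provenance and what is NOT done.  The sixteen ENTRIES (`λ` at one corner, `B` on one bond) are in parts 1–2
(`WilsonBackgroundWard22`, `WilsonBackgroundWard22Upper`); THIS FILE sums them over the bonds: for each corner `x_k` the COLUMN
`bgWard22_x{k}` with the background `B = (B₁, B₂, B₃, B₄)` ARBITRARY (and `h` arbitrary, as before).  Ingredients, all [folklore]:
§1 generic bookkeeping in an abelian group (`bond_sum₄`: «entries ⇒ column» for one quadratic and four additive functionals;
`corner_sum₄`: «columns ⇒ all letters», used by part 4 `WilsonBackgroundWard22All`) over an3's `WilsonWard22.polar_sum₄`/`add_sum₄`;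
§2 the B-DEGREE of the plaquette jets — `P22 ∘ plaq` is B-QUADRATIC (`P22_plaq_polarB₃`, third difference in the background quadruple
vanishes identically: the background twin of an3's `WilsonWard22.P22_plaq_polar₃`, same proof — recursions unfolded, `(2:𝕜)⁻¹ •` read through
`Algebra.smul_def`, `noncomm_ring`, `maxHeartbeats` raised), `P21 ∘ plaq` is B-ADDITIVE (`P21_plaq_addB`), `P21` vanishes without B-letters
(`P21_plaq_zeroB`) — ring identities, all letters, no trace; §3 the four columns, each = `bond_sum₄` on `G := 𝔸 × 𝔸 × 𝔸 × 𝔸` fed with the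
four entries BY NAME and `simp only` bookkeeping of the quadruples (an3's `WilsonWard22.ward22` pattern).

NOT IN PRINT; OUR BOOKKEEPING (cell `pub-balaban`, β sub-cell, D1 formalisation swarm seat `b2b-balaban-beta-d1-formalise-leaf-09`, gen 3).
HONEST FRAMING (cell contract, verbatim): «discharging `BetaPertH` makes Bałaban's UV stability UNCONDITIONAL — a real constructive-QFT
result; it is NOT the continuum limit and NOT the Clay problem.»  HONEST DEPENDENCY (verbatim): «continuum YM on T⁴ ⇐ BetaPertH ∧ nine
spine estimates (0/9 proved); BetaPertH ⇐ (D1) ∧ (D4) ∧ CAP+tail; G-an2-4 gates asym, D1 and NE2/3/4.»  THIS FILE DISCHARGES NOTHING of the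
wall; multilinear algebra in an arbitrary normed algebra; no binder of (D1) instantiated; not summit progress, not continuum, not Clay.
ABSOLUTE RULE (cell, verbatim): «No internally-minted statement may enter as a cited fact. Every hypothesis is either kernel-proved in this
package or a verbatim quotation of a PUBLISHED theorem with page reference. The manuscript(s) under audit are NOT citable for their own
disputed steps — they are the thing under adjudication; programme-internal (2001/route/tribunal) claims are never citable.»  Nothing is
cited; no `def` at all; everything is kernel-proved from an3's `Beta.WilsonWard22` (+ its imports) and parts 1–2 BY NAME.
-/

namespace Summit.QuantumFields.BalabanUV.Beta.WilsonBackgroundWard22Columns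

open Literature.MathematicalPhysics.QuantumFieldTheory.Balaban1983to89.Beta.TransportVertices
open Literature.MathematicalPhysics.QuantumFieldTheory.Balaban1983to89.Beta.WilsonVertex
open Literature.MathematicalPhysics.QuantumFieldTheory.Balaban1983to89.Beta.WilsonVertex2
open Literature.MathematicalPhysics.QuantumFieldTheory.Balaban1983to89.Beta.WilsonWard22 (polar_sum₄ add_sum₄ P21_plaq_polar₃ P21_plaq_zero)

/-! ## §1 Generic bookkeeping in an abelian group -/

section Generic

variable {G H : Type*} [AddCommGroup G] [AddCommGroup H]

/-- [folklore] **BONDS ⇒ COLUMN (generic).**  `A` «quadratic» (third differences vanish), `Φ₁ Φ₂ Φ₃ Ψ` additive; if for each of four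
arguments `x_m` (with companions `d_m`) `A (x_m + v) − A x_m − A v + (Φ₁ x_m − Φ₂ x_m − Φ₃ x_m) + Ψ d_m = 0`, then the same holds at the
sums `Σ x_m`, `Σ d_m` (the polar form of `A` against the FIXED `v` is additive). -/
theorem bond_sum₄ (A Φ₁ Φ₂ Φ₃ Ψ : G → H)
    (hA : ∀ x y z : G, A (x + y + z) - A (x + y) - A (x + z) - A (y + z) + A x + A y + A z = 0)
    (hΦ₁ : ∀ x y : G, Φ₁ (x + y) = Φ₁ x + Φ₁ y) (hΦ₂ : ∀ x y : G, Φ₂ (x + y) = Φ₂ x + Φ₂ y)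
    (hΦ₃ : ∀ x y : G, Φ₃ (x + y) = Φ₃ x + Φ₃ y) (hΨ : ∀ x y : G, Ψ (x + y) = Ψ x + Ψ y)
    (v x₁ x₂ x₃ x₄ d₁ d₂ d₃ d₄ : G)
    (e₁ : A (x₁ + v) - A x₁ - A v + (Φ₁ x₁ - Φ₂ x₁ - Φ₃ x₁) + Ψ d₁ = 0)
    (e₂ : A (x₂ + v) - A x₂ - A v + (Φ₁ x₂ - Φ₂ x₂ - Φ₃ x₂) + Ψ d₂ = 0)
    (e₃ : A (x₃ + v) - A x₃ - A v + (Φ₁ x₃ - Φ₂ x₃ - Φ₃ x₃) + Ψ d₃ = 0)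
    (e₄ : A (x₄ + v) - A x₄ - A v + (Φ₁ x₄ - Φ₂ x₄ - Φ₃ x₄) + Ψ d₄ = 0) :
    A (x₁ + x₂ + x₃ + x₄ + v) - A (x₁ + x₂ + x₃ + x₄) - A v
      + (Φ₁ (x₁ + x₂ + x₃ + x₄) - Φ₂ (x₁ + x₂ + x₃ + x₄) - Φ₃ (x₁ + x₂ + x₃ + x₄)) + Ψ (d₁ + d₂ + d₃ + d₄) = 0 := by
  have hP := polar_sum₄ A hA v x₁ x₂ x₃ x₄
  rw [add_comm (x₁ + x₂ + x₃ + x₄) v, add_sum₄ Φ₁ hΦ₁, add_sum₄ Φ₂ hΦ₂,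
    add_sum₄ Φ₃ hΦ₃, add_sum₄ Ψ hΨ]
  rw [add_comm x₁ v] at e₁; rw [add_comm x₂ v] at e₂; rw [add_comm x₃ v] at e₃; rw [add_comm x₄ v] at e₄
  calc _ = (A (v + (x₁ + x₂ + x₃ + x₄)) - A v - A (x₁ + x₂ + x₃ + x₄))
        + (Φ₁ x₁ + Φ₁ x₂ + Φ₁ x₃ + Φ₁ x₄ - (Φ₂ x₁ + Φ₂ x₂ + Φ₂ x₃ + Φ₂ x₄) - (Φ₃ x₁ + Φ₃ x₂ + Φ₃ x₃ + Φ₃ x₄))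
        + (Ψ d₁ + Ψ d₂ + Ψ d₃ + Ψ d₄) := by abel
    _ = (A (v + x₁) - A x₁ - A v + (Φ₁ x₁ - Φ₂ x₁ - Φ₃ x₁) + Ψ d₁)
        + (A (v + x₂) - A x₂ - A v + (Φ₁ x₂ - Φ₂ x₂ - Φ₃ x₂) + Ψ d₂)
        + (A (v + x₃) - A x₃ - A v + (Φ₁ x₃ - Φ₂ x₃ - Φ₃ x₃) + Ψ d₃)
        + (A (v + x₄) - A x₄ - A v + (Φ₁ x₄ - Φ₂ x₄ - Φ₃ x₄) + Ψ d₄) := by rw [hP]; abel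
    _ = 0 := by rw [e₁, e₂, e₃, e₄]; abel

/-- [folklore] **COLUMNS ⇒ ALL LETTERS (generic).**  `A`, `Φ` «quadratic», `Ψ` additive; if for each of four triples `(v_k, a_k, d_k)`
`A (B + v_k) − A B − A v_k + (Φ (h + a_k) − Φ h − Φ a_k) + Ψ d_k = 0`, then the same holds at the sums. -/
theorem corner_sum₄ (A Φ Ψ : G → H)
    (hA : ∀ x y z : G, A (x + y + z) - A (x + y) - A (x + z) - A (y + z) + A x + A y + A z = 0)
    (hΦ : ∀ x y z : G, Φ (x + y + z) - Φ (x + y) - Φ (x + z) - Φ (y + z) + Φ x + Φ y + Φ z = 0)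
    (hΨ : ∀ x y : G, Ψ (x + y) = Ψ x + Ψ y)
    (B h v₁ v₂ v₃ v₄ a₁ a₂ a₃ a₄ d₁ d₂ d₃ d₄ : G)
    (c₁ : A (B + v₁) - A B - A v₁ + (Φ (h + a₁) - Φ h - Φ a₁) + Ψ d₁ = 0)
    (c₂ : A (B + v₂) - A B - A v₂ + (Φ (h + a₂) - Φ h - Φ a₂) + Ψ d₂ = 0)
    (c₃ : A (B + v₃) - A B - A v₃ + (Φ (h + a₃) - Φ h - Φ a₃) + Ψ d₃ = 0)
    (c₄ : A (B + v₄) - A B - A v₄ + (Φ (h + a₄) - Φ h - Φ a₄) + Ψ d₄ = 0) :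
    A (B + (v₁ + v₂ + v₃ + v₄)) - A B - A (v₁ + v₂ + v₃ + v₄)
      + (Φ (h + (a₁ + a₂ + a₃ + a₄)) - Φ h - Φ (a₁ + a₂ + a₃ + a₄)) + Ψ (d₁ + d₂ + d₃ + d₄) = 0 := by
  rw [polar_sum₄ A hA B v₁ v₂ v₃ v₄, polar_sum₄ Φ hΦ h a₁ a₂ a₃ a₄, add_sum₄ Ψ hΨ]
  calc _ = (A (B + v₁) - A B - A v₁ + (Φ (h + a₁) - Φ h - Φ a₁) + Ψ d₁)
        + (A (B + v₂) - A B - A v₂ + (Φ (h + a₂) - Φ h - Φ a₂) + Ψ d₂)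
        + (A (B + v₃) - A B - A v₃ + (Φ (h + a₃) - Φ h - Φ a₃) + Ψ d₃)
        + (A (B + v₄) - A B - A v₄ + (Φ (h + a₄) - Φ h - Φ a₄) + Ψ d₄) := by abel
    _ = 0 := by rw [c₁, c₂, c₃, c₄]; abel

end Generic

/-! ## §2 B-degree of the plaquette jets: `P22 ∘ plaq` is B-quadratic, `P21 ∘ plaq` is B-additive (all letters, no trace) -/

section Degree

variable (𝕜 : Type*) [RCLike 𝕜] {𝔸 : Type*} [NormedRing 𝔸] [NormedAlgebra 𝕜 𝔸]
variable (W₁ W₂ W₃ W₄ : 𝔸)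

set_option maxHeartbeats 4000000 in
/-- [folklore] **`P22 ∘ plaq` IS B-QUADRATIC**: its third difference in the B-quadruple vanishes identically (every monomial of the
`(2,2)`-component carries exactly two B-letters) — the background twin of an3's `WilsonWard22.P22_plaq_polar₃`. -/
theorem P22_plaq_polarB₃ (x₁ x₂ x₃ x₄ y₁ y₂ y₃ y₄ z₁ z₂ z₃ z₄ : 𝔸) :
    P22 𝕜 (plaq W₁ W₂ W₃ W₄ (x₁ + y₁ + z₁) (x₂ + y₂ + z₂) (x₃ + y₃ + z₃) (x₄ + y₄ + z₄))
      - P22 𝕜 (plaq W₁ W₂ W₃ W₄ (x₁ + y₁) (x₂ + y₂) (x₃ + y₃) (x₄ + y₄))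
      - P22 𝕜 (plaq W₁ W₂ W₃ W₄ (x₁ + z₁) (x₂ + z₂) (x₃ + z₃) (x₄ + z₄))
      - P22 𝕜 (plaq W₁ W₂ W₃ W₄ (y₁ + z₁) (y₂ + z₂) (y₃ + z₃) (y₄ + z₄))
      + P22 𝕜 (plaq W₁ W₂ W₃ W₄ x₁ x₂ x₃ x₄) + P22 𝕜 (plaq W₁ W₂ W₃ W₄ y₁ y₂ y₃ y₄)
      + P22 𝕜 (plaq W₁ W₂ W₃ W₄ z₁ z₂ z₃ z₄) = 0 := by
  simp only [plaq, P22_consW, P22_consB, P22_nil, P21_consW, P21_consB, P21_nil, P12_consW, P12_consB, P12_nil,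
    P11_consW, P11_consB, P11_nil, quad_cons, quad_nil, wpart_consW, wpart_consB, wpart_nil, bpart_consW, bpart_consB,
    bpart_nil, List.sum_cons, List.sum_nil, Algebra.smul_def]
  noncomm_ring

set_option maxHeartbeats 4000000 in
/-- [folklore] **`P21 ∘ plaq` IS B-ADDITIVE** (one B-letter per monomial). -/
theorem P21_plaq_addB (x₁ x₂ x₃ x₄ y₁ y₂ y₃ y₄ : 𝔸) :
    P21 𝕜 (plaq W₁ W₂ W₃ W₄ (x₁ + y₁) (x₂ + y₂) (x₃ + y₃) (x₄ + y₄)) =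
      P21 𝕜 (plaq W₁ W₂ W₃ W₄ x₁ x₂ x₃ x₄) + P21 𝕜 (plaq W₁ W₂ W₃ W₄ y₁ y₂ y₃ y₄) := by
  simp only [plaq, P21_consW, P21_consB, P21_nil, P11_consW, P11_consB, P11_nil, quad_cons, quad_nil, wpart_consW,
    wpart_consB, wpart_nil, bpart_consW, bpart_consB, bpart_nil, List.sum_cons, List.sum_nil, Algebra.smul_def]
  noncomm_ring

/-- [folklore] `P21` of the plaquette word with zero B-letters vanishes. -/
theorem P21_plaq_zeroB : P21 𝕜 (plaq W₁ W₂ W₃ W₄ 0 0 0 0) = 0 := by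
  simp [plaq]

end Degree

/-! ## §3 The four columns (the background quadruple general), from the entries -/

section Columns

variable (𝕜 : Type*) [RCLike 𝕜] {𝔸 : Type*} [NormedRing 𝔸] [NormedAlgebra 𝕜 𝔸]
variable {V : Type*} [AddCommGroup V] [Module 𝕜 V]
variable (τ : 𝔸 →ₗ[𝕜] V) (h₁ h₂ h₃ h₄ B₁ B₂ B₃ B₄ l : 𝔸)

/-- [folklore] **Column `x_1`** of (bgW₂): `λ = l` at the base corner `x₁` (start of `b₁`, `b₄`), the background `B = (B₁, B₂, B₃, B₄)` and the fluctuation `h = (h₁, h₂, h₃, h₄)` ARBITRARY; the rotated-letter slots carry `[l, B_m]` exactly on the bonds touching `x_1`.  PROOF: the four entries `bgWard22_x1_b1 … b4` BY NAME, summed over the bonds by `bond_sum₄` (`P22 ∘ plaq` B-quadratic, `P21 ∘ plaq` B-additive). -/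
theorem bgWard22_x1 (hτ : ∀ a b : 𝔸, τ (a * b) = τ (b * a)) :
    (4 : 𝕜) • τ (P22 𝕜 (plaq h₁ h₂ h₃ h₄ (B₁ + l) B₂ B₃ (B₄ + l)))
      - (4 : 𝕜) • τ (P22 𝕜 (plaq h₁ h₂ h₃ h₄ B₁ B₂ B₃ B₄))
      - (4 : 𝕜) • τ (P22 𝕜 (plaq h₁ h₂ h₃ h₄ l 0 0 l))
      + ((4 : 𝕜) • τ (P21 𝕜 (plaq (h₁ + (l * h₁ - h₁ * l)) h₂ h₃ (h₄ + (l * h₄ - h₄ * l)) B₁ B₂ B₃ B₄))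
          - (4 : 𝕜) • τ (P21 𝕜 (plaq h₁ h₂ h₃ h₄ B₁ B₂ B₃ B₄))
          - (4 : 𝕜) • τ (P21 𝕜 (plaq (l * h₁ - h₁ * l) 0 0 (l * h₄ - h₄ * l) B₁ B₂ B₃ B₄)))
      + (2 : 𝕜) • τ (P21 𝕜 (plaq h₁ h₂ h₃ h₄ (l * B₁ - B₁ * l) 0 0 (l * B₄ - B₄ * l)))
      = 0 := by
  have key := bond_sum₄ (G := 𝔸 × 𝔸 × 𝔸 × 𝔸)
    (fun x => (4 : 𝕜) • τ (P22 𝕜 (plaq h₁ h₂ h₃ h₄ x.1 x.2.1 x.2.2.1 x.2.2.2)))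
    (fun x => (4 : 𝕜) • τ (P21 𝕜 (plaq (h₁ + (l * h₁ - h₁ * l)) h₂ h₃ (h₄ + (l * h₄ - h₄ * l)) x.1 x.2.1 x.2.2.1 x.2.2.2)))
    (fun x => (4 : 𝕜) • τ (P21 𝕜 (plaq h₁ h₂ h₃ h₄ x.1 x.2.1 x.2.2.1 x.2.2.2)))
    (fun x => (4 : 𝕜) • τ (P21 𝕜 (plaq (l * h₁ - h₁ * l) 0 0 (l * h₄ - h₄ * l) x.1 x.2.1 x.2.2.1 x.2.2.2)))
    (fun x => (2 : 𝕜) • τ (P21 𝕜 (plaq h₁ h₂ h₃ h₄ x.1 x.2.1 x.2.2.1 x.2.2.2)))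
    (by
      rintro ⟨x₁, x₂, x₃, x₄⟩ ⟨y₁, y₂, y₃, y₄⟩ ⟨z₁, z₂, z₃, z₄⟩
      have e := congrArg (fun a : 𝔸 => (4 : 𝕜) • τ a) (P22_plaq_polarB₃ 𝕜 h₁ h₂ h₃ h₄ x₁ x₂ x₃ x₄ y₁ y₂ y₃ y₄ z₁ z₂ z₃ z₄)
      simpa only [Prod.mk_add_mk, map_add, map_sub, map_zero, smul_add, smul_sub, smul_zero] using e)
    (by
      rintro ⟨x₁, x₂, x₃, x₄⟩ ⟨y₁, y₂, y₃, y₄⟩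
      simp only [Prod.mk_add_mk, P21_plaq_addB, map_add, smul_add])
    (by
      rintro ⟨x₁, x₂, x₃, x₄⟩ ⟨y₁, y₂, y₃, y₄⟩
      simp only [Prod.mk_add_mk, P21_plaq_addB, map_add, smul_add])
    (by
      rintro ⟨x₁, x₂, x₃, x₄⟩ ⟨y₁, y₂, y₃, y₄⟩
      simp only [Prod.mk_add_mk, P21_plaq_addB, map_add, smul_add])
    (by
      rintro ⟨x₁, x₂, x₃, x₄⟩ ⟨y₁, y₂, y₃, y₄⟩
      simp only [Prod.mk_add_mk, P21_plaq_addB, map_add, smul_add])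
    (l, 0, 0, l) (B₁, 0, 0, 0) (0, B₂, 0, 0) (0, 0, B₃, 0) (0, 0, 0, B₄)
    ((l * B₁ - B₁ * l), 0, 0, 0) (0 : 𝔸 × 𝔸 × 𝔸 × 𝔸) (0 : 𝔸 × 𝔸 × 𝔸 × 𝔸) (0, 0, 0, (l * B₄ - B₄ * l))
    (by
      simpa only [Prod.mk_add_mk, Prod.fst_zero, Prod.snd_zero, add_zero, zero_add, ← sub_eq_add_neg, zero_sub, sub_self, sub_zero, P21_plaq_zeroB, P21_plaq_zero, map_zero, smul_zero, add_sub_assoc]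
        using WilsonBackgroundWard22.bgWard22_x1_b1 𝕜 τ h₁ h₂ h₃ h₄ B₁ l hτ)
    (by
      simpa only [Prod.mk_add_mk, Prod.fst_zero, Prod.snd_zero, add_zero, zero_add, ← sub_eq_add_neg, zero_sub, sub_self, sub_zero, P21_plaq_zeroB, P21_plaq_zero, map_zero, smul_zero, add_sub_assoc]
        using WilsonBackgroundWard22.bgWard22_x1_b2 𝕜 τ h₁ h₂ h₃ h₄ B₂ l hτ)
    (by
      simpa only [Prod.mk_add_mk, Prod.fst_zero, Prod.snd_zero, add_zero, zero_add, ← sub_eq_add_neg, zero_sub, sub_self, sub_zero, P21_plaq_zeroB, P21_plaq_zero, map_zero, smul_zero, add_sub_assoc]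
        using WilsonBackgroundWard22.bgWard22_x1_b3 𝕜 τ h₁ h₂ h₃ h₄ B₃ l hτ)
    (by
      simpa only [Prod.mk_add_mk, Prod.fst_zero, Prod.snd_zero, add_zero, zero_add, ← sub_eq_add_neg, zero_sub, sub_self, sub_zero, P21_plaq_zeroB, P21_plaq_zero, map_zero, smul_zero, add_sub_assoc]
        using WilsonBackgroundWard22.bgWard22_x1_b4 𝕜 τ h₁ h₂ h₃ h₄ B₄ l hτ)
  simpa only [Prod.mk_add_mk, Prod.fst_zero, Prod.snd_zero, add_zero, zero_add, ← sub_eq_add_neg, zero_sub, sub_self, sub_zero, P21_plaq_zeroB, P21_plaq_zero, map_zero, smul_zero] using key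

/-- [folklore] **Column `x_2`** of (bgW₂): `λ = l` at `x₂` (end of `b₁`, start of `b₂`), the background `B = (B₁, B₂, B₃, B₄)` and the fluctuation `h = (h₁, h₂, h₃, h₄)` ARBITRARY; the rotated-letter slots carry `[l, B_m]` exactly on the bonds touching `x_2`.  PROOF: the four entries `bgWard22_x2_b1 … b4` BY NAME, summed over the bonds by `bond_sum₄` (`P22 ∘ plaq` B-quadratic, `P21 ∘ plaq` B-additive). -/
theorem bgWard22_x2 (hτ : ∀ a b : 𝔸, τ (a * b) = τ (b * a)) :
    (4 : 𝕜) • τ (P22 𝕜 (plaq h₁ h₂ h₃ h₄ (B₁ - l) (B₂ + l) B₃ B₄))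
      - (4 : 𝕜) • τ (P22 𝕜 (plaq h₁ h₂ h₃ h₄ B₁ B₂ B₃ B₄))
      - (4 : 𝕜) • τ (P22 𝕜 (plaq h₁ h₂ h₃ h₄ (-l) l 0 0))
      + ((4 : 𝕜) • τ (P21 𝕜 (plaq h₁ (h₂ + (l * h₂ - h₂ * l)) h₃ h₄ B₁ B₂ B₃ B₄))
          - (4 : 𝕜) • τ (P21 𝕜 (plaq h₁ h₂ h₃ h₄ B₁ B₂ B₃ B₄))
          - (4 : 𝕜) • τ (P21 𝕜 (plaq 0 (l * h₂ - h₂ * l) 0 0 B₁ B₂ B₃ B₄)))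
      + (2 : 𝕜) • τ (P21 𝕜 (plaq h₁ h₂ h₃ h₄ (l * B₁ - B₁ * l) (l * B₂ - B₂ * l) 0 0))
      = 0 := by
  have key := bond_sum₄ (G := 𝔸 × 𝔸 × 𝔸 × 𝔸)
    (fun x => (4 : 𝕜) • τ (P22 𝕜 (plaq h₁ h₂ h₃ h₄ x.1 x.2.1 x.2.2.1 x.2.2.2)))
    (fun x => (4 : 𝕜) • τ (P21 𝕜 (plaq h₁ (h₂ + (l * h₂ - h₂ * l)) h₃ h₄ x.1 x.2.1 x.2.2.1 x.2.2.2)))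
    (fun x => (4 : 𝕜) • τ (P21 𝕜 (plaq h₁ h₂ h₃ h₄ x.1 x.2.1 x.2.2.1 x.2.2.2)))
    (fun x => (4 : 𝕜) • τ (P21 𝕜 (plaq 0 (l * h₂ - h₂ * l) 0 0 x.1 x.2.1 x.2.2.1 x.2.2.2)))
    (fun x => (2 : 𝕜) • τ (P21 𝕜 (plaq h₁ h₂ h₃ h₄ x.1 x.2.1 x.2.2.1 x.2.2.2)))
    (by
      rintro ⟨x₁, x₂, x₃, x₄⟩ ⟨y₁, y₂, y₃, y₄⟩ ⟨z₁, z₂, z₃, z₄⟩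
      have e := congrArg (fun a : 𝔸 => (4 : 𝕜) • τ a) (P22_plaq_polarB₃ 𝕜 h₁ h₂ h₃ h₄ x₁ x₂ x₃ x₄ y₁ y₂ y₃ y₄ z₁ z₂ z₃ z₄)
      simpa only [Prod.mk_add_mk, map_add, map_sub, map_zero, smul_add, smul_sub, smul_zero] using e)
    (by
      rintro ⟨x₁, x₂, x₃, x₄⟩ ⟨y₁, y₂, y₃, y₄⟩
      simp only [Prod.mk_add_mk, P21_plaq_addB, map_add, smul_add])
    (by
      rintro ⟨x₁, x₂, x₃, x₄⟩ ⟨y₁, y₂, y₃, y₄⟩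
      simp only [Prod.mk_add_mk, P21_plaq_addB, map_add, smul_add])
    (by
      rintro ⟨x₁, x₂, x₃, x₄⟩ ⟨y₁, y₂, y₃, y₄⟩
      simp only [Prod.mk_add_mk, P21_plaq_addB, map_add, smul_add])
    (by
      rintro ⟨x₁, x₂, x₃, x₄⟩ ⟨y₁, y₂, y₃, y₄⟩
      simp only [Prod.mk_add_mk, P21_plaq_addB, map_add, smul_add])
    (-l, l, 0, 0) (B₁, 0, 0, 0) (0, B₂, 0, 0) (0, 0, B₃, 0) (0, 0, 0, B₄)
    ((l * B₁ - B₁ * l), 0, 0, 0) (0, (l * B₂ - B₂ * l), 0, 0) (0 : 𝔸 × 𝔸 × 𝔸 × 𝔸) (0 : 𝔸 × 𝔸 × 𝔸 × 𝔸)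
    (by
      simpa only [Prod.mk_add_mk, Prod.fst_zero, Prod.snd_zero, add_zero, zero_add, ← sub_eq_add_neg, zero_sub, sub_self, sub_zero, P21_plaq_zeroB, P21_plaq_zero, map_zero, smul_zero, add_sub_assoc]
        using WilsonBackgroundWard22.bgWard22_x2_b1 𝕜 τ h₁ h₂ h₃ h₄ B₁ l hτ)
    (by
      simpa only [Prod.mk_add_mk, Prod.fst_zero, Prod.snd_zero, add_zero, zero_add, ← sub_eq_add_neg, zero_sub, sub_self, sub_zero, P21_plaq_zeroB, P21_plaq_zero, map_zero, smul_zero, add_sub_assoc]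
        using WilsonBackgroundWard22.bgWard22_x2_b2 𝕜 τ h₁ h₂ h₃ h₄ B₂ l hτ)
    (by
      simpa only [Prod.mk_add_mk, Prod.fst_zero, Prod.snd_zero, add_zero, zero_add, ← sub_eq_add_neg, zero_sub, sub_self, sub_zero, P21_plaq_zeroB, P21_plaq_zero, map_zero, smul_zero, add_sub_assoc]
        using WilsonBackgroundWard22.bgWard22_x2_b3 𝕜 τ h₁ h₂ h₃ h₄ B₃ l hτ)
    (by
      simpa only [Prod.mk_add_mk, Prod.fst_zero, Prod.snd_zero, add_zero, zero_add, ← sub_eq_add_neg, zero_sub, sub_self, sub_zero, P21_plaq_zeroB, P21_plaq_zero, map_zero, smul_zero, add_sub_assoc]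
        using WilsonBackgroundWard22.bgWard22_x2_b4 𝕜 τ h₁ h₂ h₃ h₄ B₄ l hτ)
  simpa only [Prod.mk_add_mk, Prod.fst_zero, Prod.snd_zero, add_zero, zero_add, ← sub_eq_add_neg, zero_sub, sub_self, sub_zero, P21_plaq_zeroB, P21_plaq_zero, map_zero, smul_zero] using key

/-- [folklore] **Column `x_3`** of (bgW₂): `λ = l` at `x₃` (end of `b₂` and `b₃`; no bond starts there: no adjoint group), the background `B = (B₁, B₂, B₃, B₄)` and the fluctuation `h = (h₁, h₂, h₃, h₄)` ARBITRARY; the rotated-letter slots carry `[l, B_m]` exactly on the bonds touching `x_3`.  PROOF: the four entries `bgWard22_x3_b1 … b4` BY NAME, summed over the bonds by `bond_sum₄` (`P22 ∘ plaq` B-quadratic, `P21 ∘ plaq` B-additive). -/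
theorem bgWard22_x3 (hτ : ∀ a b : 𝔸, τ (a * b) = τ (b * a)) :
    (4 : 𝕜) • τ (P22 𝕜 (plaq h₁ h₂ h₃ h₄ B₁ (B₂ - l) (B₃ - l) B₄))
      - (4 : 𝕜) • τ (P22 𝕜 (plaq h₁ h₂ h₃ h₄ B₁ B₂ B₃ B₄))
      - (4 : 𝕜) • τ (P22 𝕜 (plaq h₁ h₂ h₃ h₄ 0 (-l) (-l) 0))
      + (2 : 𝕜) • τ (P21 𝕜 (plaq h₁ h₂ h₃ h₄ 0 (l * B₂ - B₂ * l) (l * B₃ - B₃ * l) 0))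
      = 0 := by
  have key := bond_sum₄ (G := 𝔸 × 𝔸 × 𝔸 × 𝔸)
    (fun x => (4 : 𝕜) • τ (P22 𝕜 (plaq h₁ h₂ h₃ h₄ x.1 x.2.1 x.2.2.1 x.2.2.2)))
    (fun _ => (0 : V))
    (fun _ => (0 : V))
    (fun _ => (0 : V))
    (fun x => (2 : 𝕜) • τ (P21 𝕜 (plaq h₁ h₂ h₃ h₄ x.1 x.2.1 x.2.2.1 x.2.2.2)))
    (by
      rintro ⟨x₁, x₂, x₃, x₄⟩ ⟨y₁, y₂, y₃, y₄⟩ ⟨z₁, z₂, z₃, z₄⟩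
      have e := congrArg (fun a : 𝔸 => (4 : 𝕜) • τ a) (P22_plaq_polarB₃ 𝕜 h₁ h₂ h₃ h₄ x₁ x₂ x₃ x₄ y₁ y₂ y₃ y₄ z₁ z₂ z₃ z₄)
      simpa only [Prod.mk_add_mk, map_add, map_sub, map_zero, smul_add, smul_sub, smul_zero] using e)
    (fun _ _ => (add_zero (0 : V)).symm)
    (fun _ _ => (add_zero (0 : V)).symm)
    (fun _ _ => (add_zero (0 : V)).symm)
    (by
      rintro ⟨x₁, x₂, x₃, x₄⟩ ⟨y₁, y₂, y₃, y₄⟩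
      simp only [Prod.mk_add_mk, P21_plaq_addB, map_add, smul_add])
    (0, -l, -l, 0) (B₁, 0, 0, 0) (0, B₂, 0, 0) (0, 0, B₃, 0) (0, 0, 0, B₄)
    (0 : 𝔸 × 𝔸 × 𝔸 × 𝔸) (0, (l * B₂ - B₂ * l), 0, 0) (0, 0, (l * B₃ - B₃ * l), 0) (0 : 𝔸 × 𝔸 × 𝔸 × 𝔸)
    (by
      simpa only [Prod.mk_add_mk, Prod.fst_zero, Prod.snd_zero, add_zero, zero_add, ← sub_eq_add_neg, zero_sub, sub_self, sub_zero, P21_plaq_zeroB, P21_plaq_zero, map_zero, smul_zero, add_sub_assoc]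
        using WilsonBackgroundWard22Upper.bgWard22_x3_b1 𝕜 τ h₁ h₂ h₃ h₄ B₁ l hτ)
    (by
      simpa only [Prod.mk_add_mk, Prod.fst_zero, Prod.snd_zero, add_zero, zero_add, ← sub_eq_add_neg, zero_sub, sub_self, sub_zero, P21_plaq_zeroB, P21_plaq_zero, map_zero, smul_zero, add_sub_assoc]
        using WilsonBackgroundWard22Upper.bgWard22_x3_b2 𝕜 τ h₁ h₂ h₃ h₄ B₂ l hτ)
    (by
      simpa only [Prod.mk_add_mk, Prod.fst_zero, Prod.snd_zero, add_zero, zero_add, ← sub_eq_add_neg, zero_sub, sub_self, sub_zero, P21_plaq_zeroB, P21_plaq_zero, map_zero, smul_zero, add_sub_assoc]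
        using WilsonBackgroundWard22Upper.bgWard22_x3_b3 𝕜 τ h₁ h₂ h₃ h₄ B₃ l hτ)
    (by
      simpa only [Prod.mk_add_mk, Prod.fst_zero, Prod.snd_zero, add_zero, zero_add, ← sub_eq_add_neg, zero_sub, sub_self, sub_zero, P21_plaq_zeroB, P21_plaq_zero, map_zero, smul_zero, add_sub_assoc]
        using WilsonBackgroundWard22Upper.bgWard22_x3_b4 𝕜 τ h₁ h₂ h₃ h₄ B₄ l hτ)
  simpa only [Prod.mk_add_mk, Prod.fst_zero, Prod.snd_zero, add_zero, zero_add, ← sub_eq_add_neg, zero_sub, sub_self, sub_zero, P21_plaq_zeroB, P21_plaq_zero, map_zero, smul_zero] using key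

/-- [folklore] **Column `x_4`** of (bgW₂): `λ = l` at `x₄` (start of `b₃`, end of `b₄`), the background `B = (B₁, B₂, B₃, B₄)` and the fluctuation `h = (h₁, h₂, h₃, h₄)` ARBITRARY; the rotated-letter slots carry `[l, B_m]` exactly on the bonds touching `x_4`.  PROOF: the four entries `bgWard22_x4_b1 … b4` BY NAME, summed over the bonds by `bond_sum₄` (`P22 ∘ plaq` B-quadratic, `P21 ∘ plaq` B-additive). -/
theorem bgWard22_x4 (hτ : ∀ a b : 𝔸, τ (a * b) = τ (b * a)) :
    (4 : 𝕜) • τ (P22 𝕜 (plaq h₁ h₂ h₃ h₄ B₁ B₂ (B₃ + l) (B₄ - l)))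
      - (4 : 𝕜) • τ (P22 𝕜 (plaq h₁ h₂ h₃ h₄ B₁ B₂ B₃ B₄))
      - (4 : 𝕜) • τ (P22 𝕜 (plaq h₁ h₂ h₃ h₄ 0 0 l (-l)))
      + ((4 : 𝕜) • τ (P21 𝕜 (plaq h₁ h₂ (h₃ + (l * h₃ - h₃ * l)) h₄ B₁ B₂ B₃ B₄))
          - (4 : 𝕜) • τ (P21 𝕜 (plaq h₁ h₂ h₃ h₄ B₁ B₂ B₃ B₄))
          - (4 : 𝕜) • τ (P21 𝕜 (plaq 0 0 (l * h₃ - h₃ * l) 0 B₁ B₂ B₃ B₄)))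
      + (2 : 𝕜) • τ (P21 𝕜 (plaq h₁ h₂ h₃ h₄ 0 0 (l * B₃ - B₃ * l) (l * B₄ - B₄ * l)))
      = 0 := by
  have key := bond_sum₄ (G := 𝔸 × 𝔸 × 𝔸 × 𝔸)
    (fun x => (4 : 𝕜) • τ (P22 𝕜 (plaq h₁ h₂ h₃ h₄ x.1 x.2.1 x.2.2.1 x.2.2.2)))
    (fun x => (4 : 𝕜) • τ (P21 𝕜 (plaq h₁ h₂ (h₃ + (l * h₃ - h₃ * l)) h₄ x.1 x.2.1 x.2.2.1 x.2.2.2)))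
    (fun x => (4 : 𝕜) • τ (P21 𝕜 (plaq h₁ h₂ h₃ h₄ x.1 x.2.1 x.2.2.1 x.2.2.2)))
    (fun x => (4 : 𝕜) • τ (P21 𝕜 (plaq 0 0 (l * h₃ - h₃ * l) 0 x.1 x.2.1 x.2.2.1 x.2.2.2)))
    (fun x => (2 : 𝕜) • τ (P21 𝕜 (plaq h₁ h₂ h₃ h₄ x.1 x.2.1 x.2.2.1 x.2.2.2)))
    (by
      rintro ⟨x₁, x₂, x₃, x₄⟩ ⟨y₁, y₂, y₃, y₄⟩ ⟨z₁, z₂, z₃, z₄⟩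
      have e := congrArg (fun a : 𝔸 => (4 : 𝕜) • τ a) (P22_plaq_polarB₃ 𝕜 h₁ h₂ h₃ h₄ x₁ x₂ x₃ x₄ y₁ y₂ y₃ y₄ z₁ z₂ z₃ z₄)
      simpa only [Prod.mk_add_mk, map_add, map_sub, map_zero, smul_add, smul_sub, smul_zero] using e)
    (by
      rintro ⟨x₁, x₂, x₃, x₄⟩ ⟨y₁, y₂, y₃, y₄⟩
      simp only [Prod.mk_add_mk, P21_plaq_addB, map_add, smul_add])
    (by
      rintro ⟨x₁, x₂, x₃, x₄⟩ ⟨y₁, y₂, y₃, y₄⟩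
      simp only [Prod.mk_add_mk, P21_plaq_addB, map_add, smul_add])
    (by
      rintro ⟨x₁, x₂, x₃, x₄⟩ ⟨y₁, y₂, y₃, y₄⟩
      simp only [Prod.mk_add_mk, P21_plaq_addB, map_add, smul_add])
    (by
      rintro ⟨x₁, x₂, x₃, x₄⟩ ⟨y₁, y₂, y₃, y₄⟩
      simp only [Prod.mk_add_mk, P21_plaq_addB, map_add, smul_add])
    (0, 0, l, -l) (B₁, 0, 0, 0) (0, B₂, 0, 0) (0, 0, B₃, 0) (0, 0, 0, B₄)
    (0 : 𝔸 × 𝔸 × 𝔸 × 𝔸) (0 : 𝔸 × 𝔸 × 𝔸 × 𝔸) (0, 0, (l * B₃ - B₃ * l), 0) (0, 0, 0, (l * B₄ - B₄ * l))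
    (by
      simpa only [Prod.mk_add_mk, Prod.fst_zero, Prod.snd_zero, add_zero, zero_add, ← sub_eq_add_neg, zero_sub, sub_self, sub_zero, P21_plaq_zeroB, P21_plaq_zero, map_zero, smul_zero, add_sub_assoc]
        using WilsonBackgroundWard22Upper.bgWard22_x4_b1 𝕜 τ h₁ h₂ h₃ h₄ B₁ l hτ)
    (by
      simpa only [Prod.mk_add_mk, Prod.fst_zero, Prod.snd_zero, add_zero, zero_add, ← sub_eq_add_neg, zero_sub, sub_self, sub_zero, P21_plaq_zeroB, P21_plaq_zero, map_zero, smul_zero, add_sub_assoc]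
        using WilsonBackgroundWard22Upper.bgWard22_x4_b2 𝕜 τ h₁ h₂ h₃ h₄ B₂ l hτ)
    (by
      simpa only [Prod.mk_add_mk, Prod.fst_zero, Prod.snd_zero, add_zero, zero_add, ← sub_eq_add_neg, zero_sub, sub_self, sub_zero, P21_plaq_zeroB, P21_plaq_zero, map_zero, smul_zero, add_sub_assoc]
        using WilsonBackgroundWard22Upper.bgWard22_x4_b3 𝕜 τ h₁ h₂ h₃ h₄ B₃ l hτ)
    (by
      simpa only [Prod.mk_add_mk, Prod.fst_zero, Prod.snd_zero, add_zero, zero_add, ← sub_eq_add_neg, zero_sub, sub_self, sub_zero, P21_plaq_zeroB, P21_plaq_zero, map_zero, smul_zero, add_sub_assoc]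
        using WilsonBackgroundWard22Upper.bgWard22_x4_b4 𝕜 τ h₁ h₂ h₃ h₄ B₄ l hτ)
  simpa only [Prod.mk_add_mk, Prod.fst_zero, Prod.snd_zero, add_zero, zero_add, ← sub_eq_add_neg, zero_sub, sub_self, sub_zero, P21_plaq_zeroB, P21_plaq_zero, map_zero, smul_zero] using key

end Columns

end Summit.QuantumFields.BalabanUV.Beta.WilsonBackgroundWard22Columns
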